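import Mathlib
import Summits.Ventures.PercRepro2.Defs
import Summits.Ventures.PercRepro2.Independence
import Summits.Ventures.PercRepro2.Harris
import Summits.Ventures.PercRepro2.Graph
import Summits.Ventures.PercRepro2.Events
import Summits.Ventures.PercRepro2.PartitionThree
import Summits.Ventures.PercRepro2.ZCTwoEdge
import Summits.Ventures.PercRepro2.ZCTwoEdgeGraph
import Summits.Ventures.PercRepro2.ZCA3TwoEdgeGraph
import Summits.Ventures.PercRepro2.ZCA3WGraph
import Summits.Ventures.PercRepro2.ZCOW

/-!
# Theorem G on the graph (MINE-A.md §70.8): (ZC) when `o` has degree two with neighbours `a₁` and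
a non-mark `w`, from (ZC) on `G − o` for the marks `(a₁, a₃, w)`
(blind cell PercRepro2, mine-a g24)

`ends : E → Sym2 V`, `f₁ = oa₁`, `f₂ = ow` the only edges at `o`.  With `ω⁻ := ω[f₁, f₂ ↦ closed]` the
structural lemmas of `ZCTwoEdgeGraph` / `ZCA3TwoEdgeGraph` / `ZCA3WGraph` apply with `o` in the
degree-two vertex's role and `a₃` as the far vertex: `{a₁ ↔ o} = {f₁} ∪ ({f₂} ∩ {a₁ ↔ w}⁻)`,
`{a₁ ↔ a₃} = {a₁ ↔ a₃}⁻ ∪ ({f₁, f₂} ∩ {w ↔ a₃}⁻)`, `{a₃ ↔ o} = ({f₁} ∩ {a₁ ↔ a₃}⁻) ∪ ({f₂} ∩ {w ↔ a₃}⁻)`,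
`C(a₁) = C(o) = {o} ∪ (C⁻(a₁) if f₁) ∪ (C⁻(w) if f₂)` on `{a₁ ↔ o}` and `C⁻(a₁)` off it.  The abstract
theorem `zc_ow` applies with `A = {a₁ ↔ a₃}⁻`, `W = {a₁ ↔ w}⁻`, `Γ = {w ↔ a₃}⁻`, `X₀ = {C⁻(a₁) ∈ 𝓔}`,
`X₁ = {{o} ∪ C⁻(a₁) ∈ 𝓔}`, `X₂ = {{o} ∪ C⁻(a₁) ∪ C⁻(w) ∈ 𝓔}`; lemma (P1) for `(a₁, a₃, w)` in `G − o`
(two forms) is `partitionThree_lattice` under `p[f₁, f₂ ↦ 0]`, and the inductive hypothesis is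
literally (ZC) under `p[f₁, f₂ ↦ 0]` for the marks `(a₁, a₃, w)` and the up-set `{S ∣ insert o S ∈ 𝓔}`.

**Theorem** (`zc_ow_graph`): (ZC)_{p[f₁,f₂↦0]}(a₁, a₃, w; 𝓔_o) ≥ 0 ⇒ (ZC)_p(a₁, a₃, o; 𝓔) ≥ 0 — the
`o`-role passes to its non-mark neighbour `w`.  One seat.
-/

namespace Summit.Ventures.PercRepro2

section GraphTheoremG

variable {V : Type*} {E : Type*} [Fintype E] [DecidableEq E] {R : Type*} [CommRing R]
  [LinearOrder R] [IsStrictOrderedRing R]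

/-- **Theorem G on the graph (MINE-A.md §70.8).**  Bond percolation on a finite graph `(V, E, ends)`
in which the mark `o` is joined to the rest only by `f₁ = oa₁` and `f₂ = ow`; `𝓔` an up-set of vertex
sets.  If (ZC) holds under `p[f₁, f₂ ↦ 0]` (the graph `G − o`) for the marks `(a₁, a₃, w)` and the
up-set `{S ∣ insert o S ∈ 𝓔}`, then (ZC) `P([a₁|a₃|o]) Cov(U, {a₁a₃o}) ≥ P([a₁|a₃o]) Cov(U, {a₁a₃|o})`
holds under `p` for the marks `(a₁, a₃, o)` and `𝓔`. -/
theorem zc_ow_graph {p : E → R} (hp : IsProbVec p) {ends : E → Sym2 V} {a₁ a₃ o w : V}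
    {f₁ f₂ : E} (hf : f₁ ≠ f₂) (hends₁ : ends f₁ = s(o, a₁)) (hends₂ : ends f₂ = s(o, w))
    (hmark : ∀ e, o ∈ ends e → e = f₁ ∨ e = f₂) (ho1 : o ≠ a₁) (ho3 : o ≠ a₃)
    {𝓔 : Set (Set V)} (h𝓔 : IsUpperSet 𝓔)
    (hZ : let p' := Function.update (Function.update p f₁ 0) f₂ 0
      let 𝓔' : Set (Set V) := {S | insert o S ∈ 𝓔}
      let e' := connEvent ends a₁ a₃
      let L' := connEvent ends a₁ w
      let U' := clusterInEvent ends a₁ 𝓔'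
      let γ' := connEvent ends a₃ w
      0 ≤ prob p' (e'ᶜ ∩ L'ᶜ ∩ γ'ᶜ) * (prob p' (U' ∩ (e' ∩ L')) - prob p' U' * prob p' (e' ∩ L'))
        - prob p' (e'ᶜ ∩ L'ᶜ ∩ γ') * (prob p' (U' ∩ (e' ∩ L'ᶜ)) - prob p' U' * prob p' (e' ∩ L'ᶜ))) :
    let e := connEvent ends a₁ a₃
    let L := connEvent ends a₁ o
    let U := clusterInEvent ends a₁ 𝓔
    let γ := connEvent ends a₃ o
    0 ≤ prob p (eᶜ ∩ Lᶜ ∩ γᶜ) * (prob p (U ∩ (e ∩ L)) - prob p U * prob p (e ∩ L))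
      - prob p (eᶜ ∩ Lᶜ ∩ γ) * (prob p (U ∩ (e ∩ Lᶜ)) - prob p U * prob p (e ∩ Lᶜ)) := by
  intro e L U γ
  simp only at hZ
  rw [connEvent_comm ends a₃ w] at hZ
  -- the events of `G − o`
  set A : Set (Config E) := {ω | Conn ends (Function.update (Function.update ω f₁ false) f₂ false) a₁ a₃} with hAdef
  set W : Set (Config E) := {ω | Conn ends (Function.update (Function.update ω f₁ false) f₂ false) a₁ w} with hWdef
  set Γ : Set (Config E) := {ω | Conn ends (Function.update (Function.update ω f₁ false) f₂ false) w a₃} with hΓdef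
  set X₀ : Set (Config E) := {ω | cluster ends (Function.update (Function.update ω f₁ false) f₂ false) a₁ ∈ 𝓔} with hX₀def
  set X₁ : Set (Config E) := {ω | {o} ∪ cluster ends (Function.update (Function.update ω f₁ false) f₂ false) a₁ ∈ 𝓔} with hX₁def
  set X₂ : Set (Config E) := {ω | {o} ∪ cluster ends (Function.update (Function.update ω f₁ false) f₂ false) a₁
      ∪ cluster ends (Function.update (Function.update ω f₁ false) f₂ false) w ∈ 𝓔} with hX₂def
  -- the four graph events in the abstract form
  have hconn : ∀ ω : Config E, Conn ends ω a₁ o ↔ ω f₁ = true ∨ (ω f₂ = true ∧ ω ∈ W) := by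
    intro ω
    constructor
    · intro h
      exact (conn_root_a3_iff hf hends₁ hends₂ hmark ho1 ω).1 (conn_symm h)
    · intro h
      exact conn_symm ((conn_root_a3_iff hf hends₁ hends₂ hmark ho1 ω).2 h)
  have hL : L = openEdge f₁ ∪ (openEdge f₂ ∩ W) := by
    ext ω
    simp only [L, Set.mem_union, Set.mem_inter_iff, mem_connEvent, mem_openEdge]
    exact hconn ω
  have he : e = A ∪ (openEdge f₁ ∩ openEdge f₂ ∩ Γ) := by
    ext ω
    simp only [e, A, Γ, Set.mem_union, Set.mem_inter_iff, Set.mem_setOf_eq, mem_connEvent,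
      mem_openEdge]
    rw [conn_a1_o_iff_w hf hends₁ hends₂ hmark ho1 ho3 ω]
    tauto
  have hγ : γ = (openEdge f₁ ∩ A) ∪ (openEdge f₂ ∩ Γ) := by
    ext ω
    simp only [γ, A, Γ, Set.mem_union, Set.mem_inter_iff, Set.mem_setOf_eq, mem_connEvent,
      mem_openEdge]
    rw [← conn_a3_o_iff_w hf hends₁ hends₂ hmark ho3 ω]
    exact ⟨conn_symm, conn_symm⟩
  have hU : U = (openEdge f₁ ∩ openEdge f₂ ∩ X₂) ∪ (L ∩ (openEdge f₁ ∩ openEdge f₂)ᶜ ∩ X₁)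
      ∪ (Lᶜ ∩ X₀) := by
    ext ω
    by_cases h3 : Conn ends ω a₁ o
    · have h3' := h3
      rw [hconn] at h3'
      simp only [U, X₂, X₁, hX₀def, L, Set.mem_union, Set.mem_inter_iff, Set.mem_compl_iff,
        Set.mem_setOf_eq, mem_clusterInEvent, mem_openEdge, mem_connEvent]
      rw [cluster_eq_of_conn h3, cluster_root_eq hf hends₁ hends₂ hmark ω]
      rcases Bool.eq_false_or_eq_true (ω f₁) with hf1 | hf1 <;>
        rcases Bool.eq_false_or_eq_true (ω f₂) with hf2 | hf2
      · simp [hf1, hf2, h3, -mem_cluster]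
      · simp [hf1, hf2, h3, -mem_cluster]
      · -- `f₁` closed, `f₂` open: the connection forces `W`, and then `C⁻(w) = C⁻(a₁)`
        have hW : ω ∈ W := by
          rcases h3' with h | ⟨_, h⟩
          · rw [hf1] at h; exact absurd h Bool.false_ne_true
          · exact h
        have hcw : cluster ends (Function.update (Function.update ω f₁ false) f₂ false) w
            = cluster ends (Function.update (Function.update ω f₁ false) f₂ false) a₁ :=
          (cluster_eq_of_conn hW).symm
        simp [hf1, hf2, h3, hcw, -mem_cluster]
      · exfalso
        rcases h3' with h | ⟨h, _⟩
        · rw [hf1] at h; exact Bool.false_ne_true h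
        · rw [hf2] at h; exact Bool.false_ne_true h
    · have hno : ¬ Conn ends ω o a₁ := fun h => h3 (conn_symm h)
      have h3' := h3
      rw [hconn] at h3'
      simp only [U, X₂, X₁, hX₀def, L, Set.mem_union, Set.mem_inter_iff, Set.mem_compl_iff,
        Set.mem_setOf_eq, mem_clusterInEvent, mem_openEdge, mem_connEvent]
      rw [cluster_eq_closeTwo_of_not_conn hf hends₁ hends₂ hmark ho1 hno]
      have hf1 : ω f₁ = false := by
        rcases Bool.eq_false_or_eq_true (ω f₁) with h | h
        · exact absurd (Or.inl h) h3'
        · exact h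
      simp [hf1, h3, -mem_cluster]
  -- the hypotheses of the abstract theorem: invariance under forcing `f₁`, `f₂`
  have hA : ∀ (ω : Config E) (b₁ b₂ : Bool),
      Function.update (Function.update ω f₁ b₁) f₂ b₂ ∈ A ↔ ω ∈ A := by
    intro ω b₁ b₂; simp only [A, Set.mem_setOf_eq, closeTwo_update]
  have hW : ∀ (ω : Config E) (b₁ b₂ : Bool),
      Function.update (Function.update ω f₁ b₁) f₂ b₂ ∈ W ↔ ω ∈ W := by
    intro ω b₁ b₂; simp only [W, Set.mem_setOf_eq, closeTwo_update]
  have hΓ : ∀ (ω : Config E) (b₁ b₂ : Bool),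
      Function.update (Function.update ω f₁ b₁) f₂ b₂ ∈ Γ ↔ ω ∈ Γ := by
    intro ω b₁ b₂; simp only [Γ, Set.mem_setOf_eq, closeTwo_update]
  have hX₀ : ∀ (ω : Config E) (b₁ b₂ : Bool),
      Function.update (Function.update ω f₁ b₁) f₂ b₂ ∈ X₀ ↔ ω ∈ X₀ := by
    intro ω b₁ b₂; simp only [hX₀def, Set.mem_setOf_eq, closeTwo_update]
  have hX₁ : ∀ (ω : Config E) (b₁ b₂ : Bool),
      Function.update (Function.update ω f₁ b₁) f₂ b₂ ∈ X₁ ↔ ω ∈ X₁ := by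
    intro ω b₁ b₂; simp only [X₁, Set.mem_setOf_eq, closeTwo_update]
  have hX₂ : ∀ (ω : Config E) (b₁ b₂ : Bool),
      Function.update (Function.update ω f₁ b₁) f₂ b₂ ∈ X₂ ↔ ω ∈ X₂ := by
    intro ω b₁ b₂; simp only [X₂, Set.mem_setOf_eq, closeTwo_update]
  -- increasing
  have hAup : IsUpperSet A := fun ω ω' hle hω => conn_mono (closeTwo_mono f₁ f₂ hle) hω
  have hWup : IsUpperSet W := fun ω ω' hle hω => conn_mono (closeTwo_mono f₁ f₂ hle) hω
  have hΓup : IsUpperSet Γ := fun ω ω' hle hω => conn_mono (closeTwo_mono f₁ f₂ hle) hω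
  have hX₀up : IsUpperSet X₀ := fun ω ω' hle hω =>
    h𝓔 (cluster_mono (closeTwo_mono f₁ f₂ hle) a₁) hω
  have hX₁up : IsUpperSet X₁ := fun ω ω' hle hω =>
    h𝓔 (Set.union_subset_union_right _ (cluster_mono (closeTwo_mono f₁ f₂ hle) a₁)) hω
  have hX₂up : IsUpperSet X₂ := fun ω ω' hle hω =>
    h𝓔 (Set.union_subset_union (Set.union_subset_union_right _
      (cluster_mono (closeTwo_mono f₁ f₂ hle) a₁)) (cluster_mono (closeTwo_mono f₁ f₂ hle) w)) hω
  -- transitivity in `G − o`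
  have hWΓ : ∀ ω, ω ∈ W → ω ∈ Γ → ω ∈ A := fun ω hw hγ => conn_trans hw hγ
  have hAW : ∀ ω, ω ∈ A → ω ∈ W → ω ∈ Γ := fun ω ha hw => conn_trans (conn_symm hw) ha
  have hAΓ : ∀ ω, ω ∈ A → ω ∈ Γ → ω ∈ W := fun ω ha hγ => conn_trans ha (conn_symm hγ)
  -- the cluster events
  have h01 : X₀ ⊆ X₁ := fun ω hω => h𝓔 Set.subset_union_right hω
  have h12 : X₁ ⊆ X₂ := fun ω hω => h𝓔 Set.subset_union_left hω
  have h12W : X₁ ∩ W = X₂ ∩ W := by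
    ext ω
    simp only [X₁, X₂, W, Set.mem_inter_iff, Set.mem_setOf_eq]
    constructor
    · rintro ⟨h, hc⟩
      refine ⟨?_, hc⟩
      rw [← cluster_eq_of_conn hc, Set.union_assoc, Set.union_self]; exact h
    · rintro ⟨h, hc⟩
      refine ⟨?_, hc⟩
      rw [← cluster_eq_of_conn hc, Set.union_assoc, Set.union_self] at h; exact h
  -- the shift `P_{p[f₁,f₂↦0]}(S) = P_p({ω ∣ ω⁻ ∈ S})`
  have shift : ∀ S : Set (Config E), prob (Function.update (Function.update p f₁ 0) f₂ 0) S
      = prob p {ω | Function.update (Function.update ω f₁ false) f₂ false ∈ S} := by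
    intro S
    rw [prob_update_zero_eq_shift, prob_update_zero_eq_shift]
    rfl
  have hp' : IsProbVec (Function.update (Function.update p f₁ 0) f₂ 0) :=
    (hp.update f₁ le_rfl zero_le_one).update f₂ le_rfl zero_le_one
  -- lemma (P1) for the marks `(a₁, a₃, w)` in `G − o`, middle vertex `a₃`
  have hP1a : prob p (A ∩ Wᶜ) * prob p (Aᶜ ∩ Wᶜ ∩ Γ) ≤ prob p (A ∩ W) * prob p (Aᶜ ∩ Wᶜ ∩ Γᶜ) := by
    have h := partitionThree_lattice hp' ends a₁ a₃ w
    rw [shift, shift, shift, shift] at h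
    have e1 : {ω : Config E | Function.update (Function.update ω f₁ false) f₂ false ∈ partABc ends a₁ a₃ w}
        = A ∩ Wᶜ := by
      ext ω
      simp only [partABc, A, W, Set.mem_setOf_eq, Set.mem_inter_iff, Set.mem_compl_iff, mem_connEvent]
    have e2 : {ω : Config E | Function.update (Function.update ω f₁ false) f₂ false ∈ partBCa ends a₁ a₃ w}
        = Aᶜ ∩ Wᶜ ∩ Γ := by
      ext ω
      simp only [partBCa, A, W, Γ, Set.mem_setOf_eq, Set.mem_inter_iff, Set.mem_compl_iff,
        mem_connEvent]
      constructor
      · rintro ⟨h1, h2⟩; exact ⟨⟨h2, fun hw => h2 (conn_trans hw (conn_symm h1))⟩, conn_symm h1⟩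
      · rintro ⟨⟨h2, _⟩, h1⟩; exact ⟨conn_symm h1, h2⟩
    have e3 : {ω : Config E | Function.update (Function.update ω f₁ false) f₂ false ∈ partAll ends a₁ a₃ w}
        = A ∩ W := by
      ext ω
      simp only [partAll, A, W, Set.mem_setOf_eq, Set.mem_inter_iff, mem_connEvent]
      constructor
      · rintro ⟨h1, h2⟩; exact ⟨h1, conn_trans h1 h2⟩
      · rintro ⟨h1, h2⟩; exact ⟨h1, conn_trans (conn_symm h1) h2⟩
    have e4 : {ω : Config E | Function.update (Function.update ω f₁ false) f₂ false ∈ partApart ends a₁ a₃ w}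
        = Aᶜ ∩ Wᶜ ∩ Γᶜ := by
      ext ω
      simp only [partApart, A, W, Γ, Set.mem_setOf_eq, Set.mem_inter_iff, Set.mem_compl_iff,
        mem_connEvent]
      constructor
      · rintro ⟨⟨h1, h2⟩, h3⟩; exact ⟨⟨h1, h2⟩, fun h => h3 (conn_symm h)⟩
      · rintro ⟨⟨h1, h2⟩, h3⟩; exact ⟨⟨h1, h2⟩, fun h => h3 (conn_symm h)⟩
    rw [e1, e2, e3, e4] at h
    exact h
  -- lemma (P1) for the marks `(a₁, w, a₃)` in `G − o`, middle vertex `w`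
  have hP1b : prob p (Aᶜ ∩ W) * prob p (Aᶜ ∩ Wᶜ ∩ Γ) ≤ prob p (A ∩ W) * prob p (Aᶜ ∩ Wᶜ ∩ Γᶜ) := by
    have h := partitionThree_lattice hp' ends a₁ w a₃
    rw [shift, shift, shift, shift] at h
    have e1 : {ω : Config E | Function.update (Function.update ω f₁ false) f₂ false ∈ partABc ends a₁ w a₃}
        = Aᶜ ∩ W := by
      ext ω
      simp only [partABc, A, W, Set.mem_setOf_eq, Set.mem_inter_iff, Set.mem_compl_iff, mem_connEvent]
      tauto
    have e2 : {ω : Config E | Function.update (Function.update ω f₁ false) f₂ false ∈ partBCa ends a₁ w a₃}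
        = Aᶜ ∩ Wᶜ ∩ Γ := by
      ext ω
      have := hAΓ ω
      simp only [partBCa, A, W, Γ, Set.mem_setOf_eq, Set.mem_inter_iff, Set.mem_compl_iff,
        mem_connEvent] at this ⊢
      tauto
    have e3 : {ω : Config E | Function.update (Function.update ω f₁ false) f₂ false ∈ partAll ends a₁ w a₃}
        = A ∩ W := by
      ext ω
      have h1 := hWΓ ω
      have h2 := hAW ω
      simp only [partAll, A, W, Γ, Set.mem_setOf_eq, Set.mem_inter_iff, mem_connEvent] at h1 h2 ⊢
      tauto
    have e4 : {ω : Config E | Function.update (Function.update ω f₁ false) f₂ false ∈ partApart ends a₁ w a₃}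
        = Aᶜ ∩ Wᶜ ∩ Γᶜ := by
      ext ω
      simp only [partApart, A, W, Γ, Set.mem_setOf_eq, Set.mem_inter_iff, Set.mem_compl_iff,
        mem_connEvent]
      tauto
    rw [e1, e2, e3, e4] at h
    exact h
  -- the inductive hypothesis in the abstract form
  have hZC : 0 ≤ prob p (Aᶜ ∩ Wᶜ ∩ Γᶜ) * (prob p (X₁ ∩ (A ∩ W)) - prob p X₁ * prob p (A ∩ W))
      - prob p (Aᶜ ∩ Wᶜ ∩ Γ) * (prob p (X₁ ∩ (A ∩ Wᶜ)) - prob p X₁ * prob p (A ∩ Wᶜ)) := by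
    simp only [shift] at hZ
    have s1 : {ω : Config E | Function.update (Function.update ω f₁ false) f₂ false ∈
        (connEvent ends a₁ a₃)ᶜ ∩ (connEvent ends a₁ w)ᶜ ∩ (connEvent ends w a₃)ᶜ} = Aᶜ ∩ Wᶜ ∩ Γᶜ := by
      ext ω; simp only [A, W, Γ, Set.mem_setOf_eq, Set.mem_inter_iff, Set.mem_compl_iff, mem_connEvent]
    have s2 : {ω : Config E | Function.update (Function.update ω f₁ false) f₂ false ∈
        clusterInEvent ends a₁ {S | insert o S ∈ 𝓔} ∩ (connEvent ends a₁ a₃ ∩ connEvent ends a₁ w)}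
        = X₁ ∩ (A ∩ W) := by
      ext ω
      simp only [X₁, A, W, Set.mem_setOf_eq, Set.mem_inter_iff, mem_connEvent, mem_clusterInEvent,
        Set.insert_eq]
    have s3 : {ω : Config E | Function.update (Function.update ω f₁ false) f₂ false ∈
        clusterInEvent ends a₁ {S | insert o S ∈ 𝓔}} = X₁ := by
      ext ω
      simp only [X₁, Set.mem_setOf_eq, mem_clusterInEvent, Set.insert_eq]
    have s4 : {ω : Config E | Function.update (Function.update ω f₁ false) f₂ false ∈
        connEvent ends a₁ a₃ ∩ connEvent ends a₁ w} = A ∩ W := by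
      ext ω; simp only [A, W, Set.mem_setOf_eq, Set.mem_inter_iff, mem_connEvent]
    have s5 : {ω : Config E | Function.update (Function.update ω f₁ false) f₂ false ∈
        (connEvent ends a₁ a₃)ᶜ ∩ (connEvent ends a₁ w)ᶜ ∩ connEvent ends w a₃} = Aᶜ ∩ Wᶜ ∩ Γ := by
      ext ω; simp only [A, W, Γ, Set.mem_setOf_eq, Set.mem_inter_iff, Set.mem_compl_iff, mem_connEvent]
    have s6 : {ω : Config E | Function.update (Function.update ω f₁ false) f₂ false ∈
        clusterInEvent ends a₁ {S | insert o S ∈ 𝓔} ∩ (connEvent ends a₁ a₃ ∩ (connEvent ends a₁ w)ᶜ)}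
        = X₁ ∩ (A ∩ Wᶜ) := by
      ext ω
      simp only [X₁, A, W, Set.mem_setOf_eq, Set.mem_inter_iff, Set.mem_compl_iff, mem_connEvent,
        mem_clusterInEvent, Set.insert_eq]
    have s7 : {ω : Config E | Function.update (Function.update ω f₁ false) f₂ false ∈
        connEvent ends a₁ a₃ ∩ (connEvent ends a₁ w)ᶜ} = A ∩ Wᶜ := by
      ext ω; simp only [A, W, Set.mem_setOf_eq, Set.mem_inter_iff, Set.mem_compl_iff, mem_connEvent]
    rw [s1, s2, s3, s4, s5, s6, s7] at hZ
    exact hZ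
  have key := zc_ow hp hf hA hW hΓ hX₀ hX₁ hX₂ hAup hWup hΓup hX₀up hX₁up hX₂up hWΓ hAW hAΓ
    h01 h12 h12W hP1a hP1b hZC
  simp only at key
  rw [hU, he, hL, hγ]
  exact key

end GraphTheoremG

end Summit.Ventures.PercRepro2
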